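import Literature.Probability.Process.BrownianVecStoppedIncrements
import HarnessLib

/-!
# Optional sampling between two stopping times for continuous martingales (pairing form)

Topic `Probability/Process`; generic (raw filtration of `ℝ≥0`, no usual conditions); theorems
only. For a real martingale `M` with a.s. continuous paths, stopping times `τ ≤ κ` and a bounded
`𝓕_τ`-measurable (complex) weight `G`, Doob's optional sampling theorem in the form

  `E[G · M_κ] = E[G · M_τ]`

(Le Gall (2016), Cor. 3.23: `E[X_κ | 𝓕_τ] = X_τ` for bounded `τ ≤ κ` and, Thm. 3.22, for
uniformly integrable `X` and arbitrary `τ ≤ κ`), under the hypotheses that are met by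
exponential martingales stopped along a time change: `κ < ∞` a.s. and the stopped processes
`M^κ`, `M^τ` a.s. bounded by a constant. The proof stops at the glued stopping time "`τ` on
`A`, `κ` off `A`" (`A ∈ 𝓕_τ`, `isStoppingTime_piecewise_of_le`), compares at a deterministic
time `t` (`Martingale.isAEMartingale_stoppedProcess`), lets `t → ∞` by bounded convergence, and
pulls the weight out of the conditional expectation:

* `setIntegral_stoppedProcess_eq_of_le` — `∫_A M^κ_t = ∫_A M^τ_t` for `A ∈ 𝓕_τ`;
* `setIntegral_stoppedValue_eq_of_le` — `∫_A M_κ = ∫_A M_τ`;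
* `integral_mul_eq_zero_of_setIntegral_eq_zero` — a real integrable `Δ` with vanishing
  integrals over `𝓖`-measurable sets is orthogonal to bounded complex `𝓖`-measurable weights;
* `integral_mul_stoppedValue_eq_of_le` — **`∫ G M_κ = ∫ G M_τ`** for bounded complex
  `𝓕_τ`-measurable `G`.

## References

* J.-F. Le Gall, *Brownian Motion, Martingales, and Stochastic Calculus* (2016), Thm. 3.22,
  Cor. 3.23, Cor. 3.24. [Legall2016]
* D. Revuz, M. Yor, *Continuous Martingales and Brownian Motion* (1999), Ch. II, Thm. (3.2).
-/

noncomputable section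

open MeasureTheory Filter Topology Set
open scoped NNReal ENNReal

namespace Literature.Probability.Process

variable {Ω : Type*} {mΩ : MeasurableSpace Ω} {P : Measure Ω} {𝓕 : Filtration ℝ≥0 mΩ}
  {M : ℝ≥0 → Ω → ℝ}

/-- **Stopped martingales between two stopping times**: for a martingale `M` with a.s. continuous
paths, stopping times `τ ≤ κ` and `A ∈ 𝓕_τ`, `∫_A M^κ_t = ∫_A M^τ_t`. [cite: Legall2016, Cor. 3.23] -/
theorem setIntegral_stoppedProcess_eq_of_le [IsFiniteMeasure P] (hM : Martingale M 𝓕 P)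
    (hcont : ∀ᵐ ω ∂P, Continuous (M · ω)) {τ κ : Ω → WithTop ℝ≥0} (hτ : IsStoppingTime 𝓕 τ)
    (hκ : IsStoppingTime 𝓕 κ) (hle : τ ≤ κ) {A : Set Ω} (hA : MeasurableSet[hτ.measurableSpace] A)
    (t : ℝ≥0) :
    ∫ ω in A, stoppedProcess M κ t ω ∂P = ∫ ω in A, stoppedProcess M τ t ω ∂P := by
  classical
  have hAm : MeasurableSet A := hτ.measurableSpace_le _ hA
  have hπst : IsStoppingTime 𝓕 (A.piecewise τ κ) := isStoppingTime_piecewise_of_le hτ hκ hle hA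
  have hMπ := hM.isAEMartingale_stoppedProcess hcont hπst.isOptionalTime
  have hMκ := hM.isAEMartingale_stoppedProcess hcont hκ.isOptionalTime
  have hMτ := hM.isAEMartingale_stoppedProcess hcont hτ.isOptionalTime
  have h0 : ∀ σ : Ω → WithTop ℝ≥0, ∀ ω, stoppedProcess M σ 0 ω = M 0 ω := fun σ ω ↦ by
    simp only [stoppedProcess]
    have : min ((0 : ℝ≥0) : WithTop ℝ≥0) (σ ω) = ((0 : ℝ≥0) : WithTop ℝ≥0) := min_eq_left bot_le
    rw [this]; rfl
  have eπ := hMπ.setIntegral_eq (show (0 : ℝ≥0) ≤ t from bot_le) MeasurableSet.univ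
  have eκ := hMκ.setIntegral_eq (show (0 : ℝ≥0) ≤ t from bot_le) MeasurableSet.univ
  simp only [Measure.restrict_univ, h0] at eπ eκ
  -- split the glued integral over `A` and `Aᶜ`
  have hpt : ∀ ω, stoppedProcess M (A.piecewise τ κ) t ω =
      A.indicator (stoppedProcess M τ t) ω + Aᶜ.indicator (stoppedProcess M κ t) ω := by
    intro ω
    by_cases hω : ω ∈ A
    · simp [stoppedProcess, Set.piecewise, hω]
    · simp [stoppedProcess, Set.piecewise, hω]
  have hiτ : Integrable (stoppedProcess M τ t) P := hMτ.integrable t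
  have hiκ : Integrable (stoppedProcess M κ t) P := hMκ.integrable t
  have e1 : ∫ ω, stoppedProcess M (A.piecewise τ κ) t ω ∂P =
      ∫ ω in A, stoppedProcess M τ t ω ∂P + ∫ ω in Aᶜ, stoppedProcess M κ t ω ∂P := by
    rw [integral_congr_ae (ae_of_all _ hpt), integral_add (hiτ.indicator hAm) (hiκ.indicator hAm.compl),
      integral_indicator hAm, integral_indicator hAm.compl]
  have e2 : ∫ ω, stoppedProcess M κ t ω ∂P =
      ∫ ω in A, stoppedProcess M κ t ω ∂P + ∫ ω in Aᶜ, stoppedProcess M κ t ω ∂P :=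
    (integral_add_compl hAm hiκ).symm
  linarith

/-- Along the natural numbers the stopped process converges to the stopped value, on the paths
where the stopping time is finite. [folklore] -/
theorem tendsto_stoppedProcess_natCast {β : Type*} [TopologicalSpace β] (u : ℝ≥0 → Ω → β)
    {κ : Ω → WithTop ℝ≥0} {ω : Ω} (hκ : κ ω ≠ ⊤) :
    Tendsto (fun n : ℕ ↦ stoppedProcess u κ n ω) atTop (𝓝 (stoppedValue u κ ω)) := by
  obtain ⟨k, hk⟩ := WithTop.ne_top_iff_exists.1 hκ
  obtain ⟨N, hN⟩ := exists_nat_ge k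
  refine tendsto_atTop_of_eventually_const (i₀ := N) fun n hn ↦ ?_
  have hle : κ ω ≤ (n : ℝ≥0) := by
    rw [← hk]; exact WithTop.coe_le_coe.2 (hN.trans (by exact_mod_cast hn))
  rw [stoppedProcess_eq_of_ge hle, stoppedValue]

/-- **Optional sampling at two stopping times, set-integral form**: for a martingale `M` with
a.s. continuous paths, stopping times `τ ≤ κ` with `κ < ∞` a.s., the stopped processes `M^τ, M^κ`
a.s. bounded by `B` at all natural times, and `A ∈ 𝓕_τ`: `∫_A M_κ = ∫_A M_τ`.
[cite: Legall2016, Thm. 3.22 and Cor. 3.23] -/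
theorem setIntegral_stoppedValue_eq_of_le [IsFiniteMeasure P] (hM : Martingale M 𝓕 P)
    (hcont : ∀ᵐ ω ∂P, Continuous (M · ω)) {τ κ : Ω → WithTop ℝ≥0} (hτ : IsStoppingTime 𝓕 τ)
    (hκ : IsStoppingTime 𝓕 κ) (hle : τ ≤ κ) (hfin : ∀ᵐ ω ∂P, κ ω ≠ ⊤) {B : ℝ}
    (hB : ∀ᵐ ω ∂P, ∀ n : ℕ, |stoppedProcess M κ n ω| ≤ B ∧ |stoppedProcess M τ n ω| ≤ B)
    {A : Set Ω} (hA : MeasurableSet[hτ.measurableSpace] A) :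
    ∫ ω in A, stoppedValue M κ ω ∂P = ∫ ω in A, stoppedValue M τ ω ∂P := by
  have hAm : MeasurableSet A := hτ.measurableSpace_le _ hA
  have hMκ := hM.isAEMartingale_stoppedProcess hcont hκ.isOptionalTime
  have hMτ := hM.isAEMartingale_stoppedProcess hcont hτ.isOptionalTime
  have hfinτ : ∀ᵐ ω ∂P, τ ω ≠ ⊤ := by
    filter_upwards [hfin] with ω hω
    exact ne_top_of_le_ne_top hω (hle ω)
  -- dominated convergence on `A` for both stopping times
  have hlim : ∀ {σ : Ω → WithTop ℝ≥0}, IsAEMartingale (stoppedProcess M σ) 𝓕 P →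
      (∀ᵐ ω ∂P, σ ω ≠ ⊤) → (∀ᵐ ω ∂P, ∀ n : ℕ, |stoppedProcess M σ n ω| ≤ B) →
      Tendsto (fun n : ℕ ↦ ∫ ω in A, stoppedProcess M σ n ω ∂P) atTop
        (𝓝 (∫ ω in A, stoppedValue M σ ω ∂P)) := by
    intro σ hMσ hfinσ hBσ
    refine tendsto_integral_of_dominated_convergence (fun _ ↦ B) (fun n ↦ ?_) (integrable_const B)
      (fun n ↦ ?_) ?_
    · exact ((hMσ.aestronglyMeasurable n).mono (𝓕.le _)).restrict
    · exact ae_restrict_of_ae (hBσ.mono fun ω hω ↦ by rw [Real.norm_eq_abs]; exact hω n)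
    · exact ae_restrict_of_ae (hfinσ.mono fun ω hω ↦ tendsto_stoppedProcess_natCast M hω)
  have h1 := hlim hMκ hfin (hB.mono fun ω hω n ↦ (hω n).1)
  have h2 := hlim hMτ hfinτ (hB.mono fun ω hω n ↦ (hω n).2)
  have heq : (fun n : ℕ ↦ ∫ ω in A, stoppedProcess M κ n ω ∂P) =
      fun n : ℕ ↦ ∫ ω in A, stoppedProcess M τ n ω ∂P :=
    funext fun n ↦ setIntegral_stoppedProcess_eq_of_le hM hcont hτ hκ hle hA n
  rw [heq] at h1
  exact tendsto_nhds_unique h1 h2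

/-- The stopped value is a.e. strongly measurable (a.e. limit of the stopped process). [folklore] -/
theorem aestronglyMeasurable_stoppedValue_of_ae [IsFiniteMeasure P] (hM : Martingale M 𝓕 P)
    (hcont : ∀ᵐ ω ∂P, Continuous (M · ω)) {κ : Ω → WithTop ℝ≥0} (hκ : IsStoppingTime 𝓕 κ)
    (hfin : ∀ᵐ ω ∂P, κ ω ≠ ⊤) : AEStronglyMeasurable (stoppedValue M κ) P := by
  have hMκ := hM.isAEMartingale_stoppedProcess hcont hκ.isOptionalTime
  exact aestronglyMeasurable_of_tendsto_ae atTop (fun n : ℕ ↦ (hMκ.aestronglyMeasurable n).mono (𝓕.le _))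
    (hfin.mono fun ω hω ↦ tendsto_stoppedProcess_natCast M hω)

/-- **A real integrable function orthogonal to all `𝓖`-measurable sets is orthogonal to all bounded
complex `𝓖`-measurable weights** (its conditional expectation given `𝓖` vanishes; pull-out).
[folklore] -/
theorem integral_mul_eq_zero_of_setIntegral_eq_zero {Ω' : Type*} {𝓖 mΩ' : MeasurableSpace Ω'}
    {P : Measure Ω'} [IsFiniteMeasure P]
    (h𝓖 : 𝓖 ≤ mΩ') {Δ : Ω' → ℝ} (hΔ : Integrable Δ P)
    (h0 : ∀ A, MeasurableSet[𝓖] A → ∫ ω in A, Δ ω ∂P = 0) {G : Ω' → ℂ}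
    (hG : AEStronglyMeasurable[𝓖] G P) {C : ℝ} (hGC : ∀ᵐ ω ∂P, ‖G ω‖ ≤ C) :
    ∫ ω, G ω * Δ ω ∂P = 0 := by
  -- the conditional expectation of `Δ` vanishes
  have hce : P[Δ | 𝓖] =ᵐ[P] 0 := by
    have h := ae_eq_condExp_of_forall_setIntegral_eq h𝓖 hΔ (g := fun _ ↦ (0 : ℝ))
      (fun _ _ _ ↦ integrableOn_zero) (fun A hA _ ↦ by rw [h0 A hA]; simp)
      aestronglyMeasurable_zero
    exact h.symm
  -- real weights
  have hreal : ∀ {H : Ω' → ℝ}, AEStronglyMeasurable[𝓖] H P → (∀ᵐ ω ∂P, ‖H ω‖ ≤ C) →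
      ∫ ω, H ω * Δ ω ∂P = 0 := by
    intro H hH hHC
    have h1 := condExp_stronglyMeasurable_mul_of_bound₀ h𝓖 hH hΔ C hHC
    calc ∫ ω, H ω * Δ ω ∂P = ∫ ω, (P[H * Δ | 𝓖]) ω ∂P := (integral_condExp h𝓖).symm
      _ = ∫ ω, (H * P[Δ | 𝓖]) ω ∂P := integral_congr_ae h1
      _ = ∫ ω, (0 : ℝ) ∂P := integral_congr_ae (by
          filter_upwards [hce] with ω hω
          simp [hω])
      _ = 0 := by simp
  have hre : AEStronglyMeasurable[𝓖] (fun ω ↦ (G ω).re) P := Complex.continuous_re.comp_aestronglyMeasurable hG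
  have him : AEStronglyMeasurable[𝓖] (fun ω ↦ (G ω).im) P := Complex.continuous_im.comp_aestronglyMeasurable hG
  have hreC : ∀ᵐ ω ∂P, ‖(G ω).re‖ ≤ C := by
    filter_upwards [hGC] with ω hω using (Complex.abs_re_le_norm _).trans hω
  have himC : ∀ᵐ ω ∂P, ‖(G ω).im‖ ≤ C := by
    filter_upwards [hGC] with ω hω using (Complex.abs_im_le_norm _).trans hω
  have e1 := hreal hre hreC
  have e2 := hreal him himC
  have hiRe := hΔ.bdd_mul (hre.mono h𝓖) hreC
  have hiIm := hΔ.bdd_mul (him.mono h𝓖) himC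
  have hdecomp : (fun ω ↦ G ω * Δ ω) =
      fun ω ↦ (((G ω).re * Δ ω : ℝ) : ℂ) + (((G ω).im * Δ ω : ℝ) : ℂ) * Complex.I := by
    ext ω
    conv_lhs => rw [← Complex.re_add_im (G ω)]
    push_cast
    ring
  rw [hdecomp, integral_add hiRe.ofReal (hiIm.ofReal.mul_const _), integral_mul_const,
    integral_complex_ofReal, integral_complex_ofReal, e1, e2]
  simp

/-- **Optional sampling at two stopping times, pairing form**: under the hypotheses of
`setIntegral_stoppedValue_eq_of_le`, `∫ G M_κ = ∫ G M_τ` for every bounded complex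
`𝓕_τ`-measurable weight `G`. [cite: Legall2016, Thm. 3.22 and Cor. 3.23] -/
theorem integral_mul_stoppedValue_eq_of_le [IsFiniteMeasure P] (hM : Martingale M 𝓕 P)
    (hcont : ∀ᵐ ω ∂P, Continuous (M · ω)) {τ κ : Ω → WithTop ℝ≥0} (hτ : IsStoppingTime 𝓕 τ)
    (hκ : IsStoppingTime 𝓕 κ) (hle : τ ≤ κ) (hfin : ∀ᵐ ω ∂P, κ ω ≠ ⊤) {B : ℝ}
    (hB : ∀ᵐ ω ∂P, ∀ n : ℕ, |stoppedProcess M κ n ω| ≤ B ∧ |stoppedProcess M τ n ω| ≤ B)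
    {G : Ω → ℂ} (hG : AEStronglyMeasurable[hτ.measurableSpace] G P) {C : ℝ} (hGC : ∀ᵐ ω ∂P, ‖G ω‖ ≤ C) :
    ∫ ω, G ω * stoppedValue M κ ω ∂P = ∫ ω, G ω * stoppedValue M τ ω ∂P := by
  have hfinτ : ∀ᵐ ω ∂P, τ ω ≠ ⊤ := by
    filter_upwards [hfin] with ω hω
    exact ne_top_of_le_ne_top hω (hle ω)
  -- integrability of the stopped values (a.e. bounded by `B`)
  have hbound : ∀ {σ : Ω → WithTop ℝ≥0}, (∀ᵐ ω ∂P, σ ω ≠ ⊤) →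
      (∀ᵐ ω ∂P, ∀ n : ℕ, |stoppedProcess M σ n ω| ≤ B) → ∀ᵐ ω ∂P, ‖stoppedValue M σ ω‖ ≤ B := by
    intro σ hfinσ hBσ
    filter_upwards [hfinσ, hBσ] with ω hω hb
    have ht := tendsto_stoppedProcess_natCast M hω
    have : Tendsto (fun n : ℕ ↦ |stoppedProcess M σ n ω|) atTop (𝓝 |stoppedValue M σ ω|) := ht.abs
    rw [Real.norm_eq_abs]
    exact le_of_tendsto' this hb
  have hiκ : Integrable (stoppedValue M κ) P :=
    ⟨aestronglyMeasurable_stoppedValue_of_ae hM hcont hκ hfin,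
      HasFiniteIntegral.of_bounded (hbound hfin (hB.mono fun ω hω n ↦ (hω n).1))⟩
  have hiτ : Integrable (stoppedValue M τ) P :=
    ⟨aestronglyMeasurable_stoppedValue_of_ae hM hcont hτ hfinτ,
      HasFiniteIntegral.of_bounded (hbound hfinτ (hB.mono fun ω hω n ↦ (hω n).2))⟩
  -- the difference is orthogonal to `𝓕_τ`
  have h0 : ∀ A, MeasurableSet[hτ.measurableSpace] A →
      ∫ ω in A, (stoppedValue M κ ω - stoppedValue M τ ω) ∂P = 0 := by
    intro A hA
    rw [integral_sub hiκ.integrableOn hiτ.integrableOn,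
      setIntegral_stoppedValue_eq_of_le hM hcont hτ hκ hle hfin hB hA, sub_self]
  have h := integral_mul_eq_zero_of_setIntegral_eq_zero hτ.measurableSpace_le
    (Δ := fun ω ↦ stoppedValue M κ ω - stoppedValue M τ ω) (hiκ.sub hiτ) h0 hG hGC
  have hiGκ : Integrable (fun ω ↦ G ω * stoppedValue M κ ω) P := by
    have := (hiκ.ofReal (𝕜 := ℂ)).bdd_mul (hG.mono hτ.measurableSpace_le) hGC
    simpa using this
  have hiGτ : Integrable (fun ω ↦ G ω * stoppedValue M τ ω) P := by
    have := (hiτ.ofReal (𝕜 := ℂ)).bdd_mul (hG.mono hτ.measurableSpace_le) hGC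
    simpa using this
  have e : ∫ ω, G ω * ((stoppedValue M κ ω - stoppedValue M τ ω : ℝ) : ℂ) ∂P =
      ∫ ω, G ω * stoppedValue M κ ω ∂P - ∫ ω, G ω * stoppedValue M τ ω ∂P := by
    rw [← integral_sub hiGκ hiGτ]
    refine integral_congr_ae (ae_of_all _ fun ω ↦ ?_)
    push_cast
    ring
  rw [e] at h
  exact sub_eq_zero.1 h

end Literature.Probability.Process

end
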